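import Summits.ResolutionOfSingularities.ResolutionOfSingularities.Theorems.PurelyInseparableDim4ResConeSlices
import Summits.ResolutionOfSingularities.ResolutionOfSingularities.Theorems.PurelyInseparableDim4ResConeSliceA
import HarnessLib
import HarnessLib.Audit.Tags

/-!
# Purely inseparable four-folds — K2(p) IS THE TWO TAME SLICES: power cones (`d < p`, `e_G = 3`) and binary
# cones (`d < p`, `e_G = 2`) — every prime

[OURS · counted 0 · cell `res-dim4-pi` · seat res-dim4-p-12 g2 · K2(p) lane (desk WORDS #66 (2), #75).]  Nothing
here proves K2(p), `NoIsolatedTrap p p` or resolution of singularities in dimension ≥ 4 / characteristic `p`.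

`…ResConeSlices.noAboveFloorTrap_iff_slices` (p-12 g2) splits K2(p) into the wild-shade slice A (`p ≤ d`) and
the tame slices B (`e_G ≡ 3`) and C (`e_G ≡ 2`); `…ResConeSliceA.no_constantShadeTrap_of_le_shade` (p-7 g2,
idea-4's (L≥): for `d ≥ p` the order never drops and rises after every satellite, FT(p,p)) empties slice A.
Hence **`noAboveFloorTrap_iff_tameSlices`**: K2(p) ⟺ no constant-`(d, e_G = 3)` trap and no
constant-`(d, e_G = 2)` trap with `1 ≤ d < p` and `x^{r₀} ∣ F₀` — where the cones are `c·ℓ^d` (`…PowerCone`)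
resp. binary forms in `K[ℓ₁, ℓ₂]` (`…Adjoin`).
bears_on: LADDER-RESOLUTION:D157-DOOR2 (res-dim4-pi · K2(p)).  Supports stmt-ResolutionOfSingularities-16155
(helper).
-/

set_option linter.dupNamespace false -- mandated namespace of this single-conjunct summit

noncomputable section

namespace Summit.ResolutionOfSingularities.ResolutionOfSingularities.Theorems.PIDim4

namespace ResCone

open MvPolynomial Finset
open Literature.AlgebraicGeometry.Resolution
open Literature.AlgebraicGeometry.Resolution.CentreBlowup
open Literature.AlgebraicGeometry.Resolution.Hauser2010
open Literature.AlgebraicGeometry.Resolution.HauserPerlega2019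

/-- **K2(p) ⟺ THE TWO TAME SLICES ARE EMPTY** (every prime `p`): `RidgeBudget.NoAboveFloorTrap p p` iff over
every field of characteristic `p` there is no isolated above-floor `Step0 p` chain with `x^{r₀} ∣ F₀`, constant
shade `1 ≤ d < p` and constant polar-kernel rank `3` (slice B, power cones), nor one with rank `2` (slice C,
binary cones). [OURS] [cite: CossartJannsenSaito2020, Thm. 3.14] -/
theorem noAboveFloorTrap_iff_tameSlices (p : ℕ) [Fact p.Prime] :
    RidgeBudget.NoAboveFloorTrap p p ↔ ∀ (K : Type) [Field K] [CharP K p] [DecidableEq K],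
      (¬ ∃ (c : ℕ → State K) (d : ℕ), 1 ≤ d ∧ d < p ∧
          (∀ e' ∈ (c 0).F.support, (c 0).r ≤ e') ∧
          ∀ k, IsIsolated p (c k).F ∧ Step0 p (c k) (c (k + 1)) ∧ ordZero (c k).F ≠ p ∧
            (c k).shade = (d : ℕ∞) ∧ Module.finrank K (resVertex (c k)) = 3) ∧
      (¬ ∃ (c : ℕ → State K) (d : ℕ), 1 ≤ d ∧ d < p ∧
          (∀ e' ∈ (c 0).F.support, (c 0).r ≤ e') ∧
          ∀ k, IsIsolated p (c k).F ∧ Step0 p (c k) (c (k + 1)) ∧ ordZero (c k).F ≠ p ∧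
            (c k).shade = (d : ℕ∞) ∧ Module.finrank K (resVertex (c k)) = 2) := by
  rw [noAboveFloorTrap_iff_slices]
  refine forall_congr' fun K => forall_congr' fun _ => forall_congr' fun _ => forall_congr' fun _ => ?_
  constructor
  · rintro ⟨-, hB, hC⟩
    exact ⟨hB, hC⟩
  · rintro ⟨hB, hC⟩
    refine ⟨?_, hB, hC⟩
    rintro ⟨c, d, e, hpd, -, -, -, -, hc⟩
    exact no_constantShadeTrap_of_le_shade p K
      ⟨c, d, hpd, fun k => ⟨(hc k).1, (hc k).2.1, (hc k).2.2.1, (hc k).2.2.2.1⟩⟩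

end ResCone

end Summit.ResolutionOfSingularities.ResolutionOfSingularities.Theorems.PIDim4

end
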